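import Summits.CriticalPhenomena.CardyFormulaZ2.Theorems.CardyMagicRigidityHexSegmentDefs
import Summits.CriticalPhenomena.CardyFormulaZ2.Theorems.CardyMagicRigidityLoopLimitZ2EqTSiteEndMetric
import Summits.CriticalPhenomena.CardyFormulaZ2.Theorems.CardyMagicRigidityLoopLimitZ2EqTCFT1
import Summits.CriticalPhenomena.CardyFormulaZ2.Theorems.CardyMagicRigidityLoopLimitZ2EqTCFT0
import HarnessLib

/-!
# Line `Sketch` for crux `LoopLimitZ2EqT` (stmt-CriticalPhenomena-4833): stub S2 `stub_siteEnd` closed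

Route `CardyMagicRigidity`, sub-problem `CriticalPhenomena/CardyFormulaZ2`. The registered stub S2 of the
skeleton `Cruxes/LoopLimitZ2EqT/Lines/Sketch.lean` — the endpoint dictionary at `t = 0` AT LOOP LEVEL
("arena identity" in DKKMO's coupling distance):

`SiteEndLoops ≡ d_CN((prodBernoulli (prm 0), segLoops δ), (triSitePercolation half, siteLoopConfig δ)) → 0`
as `δ → 0⁺`,

i.e. the typed loop ensemble of the all-or-nothing endpoint `M₀` of the C₃-symmetric self-dual hyperlattice
segment (bond configuration `cfg S` on `𝕋̃` read through the half-mesh refinement `refine`, honeycomb loops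
at mesh `δ/2`) merges with the site-`𝕋` ensemble of the crux. Assembly of the landed pieces: the reduction
`siteEnd_of_cft` (file `…SiteEndMetric.lean`: law of the fair-coin layer, a.e. all-or-nothing form of `cfg`,
arena identity `refine (A τ) = β τ`, loops ↔ finite clusters, stutter-invariant discrete Fréchet bound on
`udist`, density of microscopic loops for the dust, diagonal coupling and `cnLawEDist_le_of_coupling`) and
the two combinatorial fellow-travelling theorems `stub_cft1` (type 1, `…CFT1.lean`) and `stub_cft0`
(type 0, `…CFT0.lean`), both with constant `C = 12`.
-/

namespace Summit.CriticalPhenomena.CardyFormulaZ2.Cruxes.LoopLimitZ2EqT.HexSegment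

/-- **S2 · the arena identity in `d_CN`** (registered stub `stub_siteEnd` of line `Sketch`): the typed
loop ensemble of the all-or-nothing segment endpoint `M₀` at mesh `δ` and the typed honeycomb loop
ensemble of critical site percolation on `δ𝕋` are `d_CN`-asymptotic as `δ → 0⁺`. -/
theorem stub_siteEnd : SiteEndLoops := siteEnd_of_cft stub_cft1 stub_cft0

end Summit.CriticalPhenomena.CardyFormulaZ2.Cruxes.LoopLimitZ2EqT.HexSegment
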